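import Mathlib
import Summits.Ventures.PercRepro2.Defs
import Summits.Ventures.PercRepro2.Independence
import Summits.Ventures.PercRepro2.Harris
import Summits.Ventures.PercRepro2.Graph
import Summits.Ventures.PercRepro2.Exploration
import Summits.Ventures.PercRepro2.Events
import Summits.Ventures.PercRepro2.Induced
import Summits.Ventures.PercRepro2.BHK
import Summits.Ventures.PercRepro2.BHKEvents

/-!
# Row 2′RB at a root or at a marker: the Rao–Blackwell sum collapses to BHK (mine-a g5; MINE-A.md §18, §28 (d))

Row 2′RB (RBDefs.lean, mine-a §18) compares the Rao–Blackwell sum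
`Σ_A P(Q ∩ {C(w) = A} ∩ X) · P(Q ∩ {C(w) = A} ∩ Y) / P(Q ∩ {C(w) = A})` (`= P(Q) · E_π[X̂ Ŷ]`,
`Q = {s ↮ t}`, `X̂ = μ(X | C(w))`) with `P(Q ∩ X) · P(Q ∩ Y) / P(Q)`. Here the row is proved for
every third vertex `w` that is a ROOT or a MARKER (`rb_of_mem`): `rbSum_of_clusterInEvent` — if
`X = {C(w) ∈ 𝓤}` the Rao–Blackwell sum COLLAPSES to `P(Q ∩ X ∩ Y)`, so (RB-cross) at
`w ∈ {s, t, b, o}` and (RB-same) at `w ∈ {s, b, o}` are literally BHK06 Theorems 1.4 / 1.3;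
(RB-same) at `w = t` does not collapse — it is the B-frame same-type atom `Cov_{C_t}(f_b, f_o) ≥ 0`,
`f_b(A) = P_{G ∖ A}(s ↔ b)`: spatial Markov + BHK 1.3 for `1 − f_b`, `1 − f_o` (`same_at_t`).
The sums are written out (only built modules are imported); `RBRootDefs.lean` identifies them
with `RB.rbSum` / `RB.RBcross` / `RB.RBsame` of RBDefs.lean.
-/

namespace Summit.Ventures.PercRepro2

namespace RBRoot

open scoped Classical

section Events

variable {V : Type*} {E : Type*} (ends : E → Sym2 V)

/-- `{b ↔ s} = {C(s) ∋ b}`. -/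
lemma connEvent_eq_clusterInEvent_right (b s : V) :
    connEvent ends b s = clusterInEvent ends s {A | b ∈ A} := by
  ext ω
  simp only [mem_connEvent, mem_clusterInEvent, Set.mem_setOf_eq, mem_cluster]
  exact ⟨conn_symm, conn_symm⟩

/-- `{b ↔ s} = {C(b) ∋ s}`. -/
lemma connEvent_eq_clusterInEvent_left (b s : V) :
    connEvent ends b s = clusterInEvent ends b {A | s ∈ A} := by
  ext ω
  simp only [mem_connEvent, mem_clusterInEvent, Set.mem_setOf_eq, mem_cluster]

/-- `{A | b ∈ A}` is an up-set of vertex sets. -/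
lemma isUpperSet_mem (b : V) : IsUpperSet {A : Set V | b ∈ A} := fun _ _ h hb => h hb

/-- `{s ↮ t} = {t ↮ s}`. -/
lemma compl_connEvent_comm (s t : V) : (connEvent ends s t)ᶜ = (connEvent ends t s)ᶜ := by
  ext ω
  simp only [Set.mem_compl_iff, mem_connEvent]
  exact not_congr ⟨conn_symm, conn_symm⟩

/-- `Q ∩ X ∩ Y = Q ∩ Y ∩ X`. -/
lemma inter_inter_comm (Q X Y : Set (Config E)) : Q ∩ X ∩ Y = Q ∩ Y ∩ X := by
  ext ω; simp only [Set.mem_inter_iff]; tauto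

/-- On `{C(t) = A}` with `s ∈ A` the roots are connected: `Q ∩ {C(t) = A} = ∅`. -/
lemma compl_inter_clusterEvent_of_mem {A : Set V} {s t : V} (hs : s ∈ A) :
    (connEvent ends s t)ᶜ ∩ clusterEvent ends t A = ∅ := by
  ext ω
  simp only [Set.mem_inter_iff, Set.mem_compl_iff, mem_connEvent, mem_clusterEvent,
    Set.mem_empty_iff_false, iff_false, not_and]
  exact fun hQ hC => hQ (conn_symm (hC.symm ▸ hs : s ∈ cluster ends ω t))

/-- On `{C(t) = A}` with `s ∉ A` the roots are disconnected: `Q ∩ {C(t) = A} = {C(t) = A}`. -/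
lemma compl_inter_clusterEvent_of_notMem {A : Set V} {s t : V} (hs : s ∉ A) :
    (connEvent ends s t)ᶜ ∩ clusterEvent ends t A = clusterEvent ends t A := by
  ext ω
  simp only [Set.mem_inter_iff, Set.mem_compl_iff, mem_connEvent, mem_clusterEvent,
    and_iff_right_iff_imp]
  exact fun hC h => hs (hC ▸ (conn_symm h : s ∈ cluster ends ω t))

end Events

section Sums

variable {V : Type*} {E : Type*} [Fintype E] [DecidableEq E] [Fintype V] {R : Type*} [Field R]
  (p : E → R) (ends : E → Sym2 V) (s t w : V)

/-- The Rao–Blackwell sum of row 2′RB, written out: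
`Σ_A P(Q ∩ {C(w) = A} ∩ X) · P(Q ∩ {C(w) = A} ∩ Y) / P(Q ∩ {C(w) = A})`, `Q = {s ↮ t}`
(`x / 0 = 0` makes the atoms of probability zero harmless). -/
noncomputable def rbSum (X Y : Set (Config E)) : R :=
  ∑ A : Set V, prob p ((connEvent ends s t)ᶜ ∩ clusterEvent ends w A ∩ X) *
      prob p ((connEvent ends s t)ᶜ ∩ clusterEvent ends w A ∩ Y) /
    prob p ((connEvent ends s t)ᶜ ∩ clusterEvent ends w A)

/-- The Rao–Blackwell sum is symmetric in the two events. -/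
lemma rbSum_comm (X Y : Set (Config E)) : rbSum p ends s t w X Y = rbSum p ends s t w Y X := by
  unfold rbSum
  exact Finset.sum_congr rfl fun A _ => by rw [mul_comm]

/-- Law of total probability over the cluster of `w`: `Σ_A P(Z ∩ {C(w) = A}) = P(Z)`. -/
lemma sum_prob_inter_clusterEvent (Z : Set (Config E)) :
    ∑ A : Set V, prob p (Z ∩ clusterEvent ends w A) = prob p Z := by
  unfold prob
  rw [Finset.sum_comm]
  refine Finset.sum_congr rfl fun ω _ => ?_
  rw [Finset.sum_eq_single (cluster ends ω w)]
  · by_cases hZ : ω ∈ Z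
    · rw [Set.indicator_of_mem hZ,
        Set.indicator_of_mem (show ω ∈ Z ∩ clusterEvent ends w _ from ⟨hZ, rfl⟩)]
    · rw [Set.indicator_of_notMem hZ, Set.indicator_of_notMem (fun h => hZ h.1)]
  · intro A _ hA
    exact Set.indicator_of_notMem (f := weight p) fun h => hA h.2.symm
  · intro h
    exact absurd (Finset.mem_univ _) h

/-- Tower over the atoms of `C(w)`: `E[F(C(w)) · 1_Z] = Σ_A F(A) · P(Z ∩ {C(w) = A})`. -/
lemma expect_cluster_mul_indicator (F : Set V → R) (Z : Set (Config E)) :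
    expect p (fun ω => F (cluster ends ω w) * Z.indicator 1 ω) =
      ∑ A : Set V, F A * prob p (Z ∩ clusterEvent ends w A) := by
  unfold expect prob
  simp_rw [Finset.mul_sum]
  rw [Finset.sum_comm]
  refine Finset.sum_congr rfl fun ω _ => ?_
  rw [Finset.sum_eq_single (cluster ends ω w)]
  · by_cases hZ : ω ∈ Z
    · rw [Set.indicator_of_mem hZ,
        Set.indicator_of_mem (show ω ∈ Z ∩ clusterEvent ends w _ from ⟨hZ, rfl⟩)]
      simp only [Pi.one_apply, mul_one]
      ring
    · rw [Set.indicator_of_notMem hZ, Set.indicator_of_notMem (fun h => hZ h.1)]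
      simp
  · intro A _ hA
    rw [Set.indicator_of_notMem fun h : ω ∈ Z ∩ clusterEvent ends w A => hA h.2.symm]
    simp
  · intro h
    exact absurd (Finset.mem_univ _) h

/-- The residual functional `f_b(A) = P_{G ∖ A}(s ↔ b)` (`delClusterProb` at the up-set
`{W | b ∈ W}`) is the probability of `{s ↔ b}` after closing the edges touching `A`. -/
lemma delClusterProb_mem_eq (b : V) (A : Set V) :
    delClusterProb p ends s {W | b ∈ W} A =
      prob p {ω | Conn ends (restrict (touches ends A)ᶜ ω) s b} := by
  unfold delClusterProb
  congr 1
  ext ω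
  simp only [Set.mem_setOf_eq, mem_cluster, delConfig_eq_restrict]

/-- **Spatial Markov on the atoms of `C(t)` under `Q`**:
`P(Q ∩ {C(t) = A} ∩ {b ↔ s}) = P(Q ∩ {C(t) = A}) · f_b(A)`. -/
lemma prob_atom_inter_conn (b : V) (A : Set V) :
    prob p ((connEvent ends s t)ᶜ ∩ clusterEvent ends t A ∩ connEvent ends b s) =
      prob p ((connEvent ends s t)ᶜ ∩ clusterEvent ends t A) *
        delClusterProb p ends s {W | b ∈ W} A := by
  by_cases hs : s ∈ A
  · rw [compl_inter_clusterEvent_of_mem ends hs, Set.empty_inter, prob_empty, zero_mul]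
  · rw [compl_inter_clusterEvent_of_notMem ends hs, delClusterProb_mem_eq]
    rw [show connEvent ends b s = connEvent ends s b by
      ext ω; simp only [mem_connEvent]; exact ⟨conn_symm, conn_symm⟩]
    exact prob_clusterEvent_inter_connEvent p ends t A hs

/-- `Σ_A P(Q ∩ {C(t) = A}) · f_b(A) = P(Q ∩ {b ↔ s})`. -/
lemma sum_atom_mul_delClusterProb (b : V) :
    ∑ A : Set V, prob p ((connEvent ends s t)ᶜ ∩ clusterEvent ends t A) *
        delClusterProb p ends s {W | b ∈ W} A =
      prob p ((connEvent ends s t)ᶜ ∩ connEvent ends b s) := by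
  simp_rw [← prob_atom_inter_conn p ends s t b]
  rw [← sum_prob_inter_clusterEvent p ends t ((connEvent ends s t)ᶜ ∩ connEvent ends b s)]
  exact Finset.sum_congr rfl fun A _ => by rw [Set.inter_right_comm]

end Sums

section Ordered

variable {V : Type*} {E : Type*} [Fintype E] [DecidableEq E] [Fintype V] {R : Type*} [Field R]
  [LinearOrder R] [IsStrictOrderedRing R] (ends : E → Sym2 V) {p : E → R}

/-- `rbSum X Y ≥ 0`. -/
lemma rbSum_nonneg (hp : IsProbVec p) (s t w : V) (X Y : Set (Config E)) :
    0 ≤ rbSum p ends s t w X Y :=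
  Finset.sum_nonneg fun _ _ => div_nonneg (mul_nonneg (prob_nonneg hp _) (prob_nonneg hp _)) (prob_nonneg hp _)

/-- **Collapse**: if `X = {C(w) ∈ 𝓤}` is determined by the cluster of `w`, the Rao–Blackwell sum
is `P(Q ∩ X ∩ Y)` — the conditional probability of `X` given `C(w)` is its own indicator. -/
theorem rbSum_of_clusterInEvent (hp : IsProbVec p) (s t w : V) (𝓤 : Set (Set V))
    (Y : Set (Config E)) :
    rbSum p ends s t w (clusterInEvent ends w 𝓤) Y =
      prob p ((connEvent ends s t)ᶜ ∩ clusterInEvent ends w 𝓤 ∩ Y) := by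
  unfold rbSum
  rw [← sum_prob_inter_clusterEvent p ends w ((connEvent ends s t)ᶜ ∩ clusterInEvent ends w 𝓤 ∩ Y)]
  refine Finset.sum_congr rfl fun A _ => ?_
  by_cases hA : A ∈ 𝓤
  · have h1 : (connEvent ends s t)ᶜ ∩ clusterEvent ends w A ∩ clusterInEvent ends w 𝓤 =
        (connEvent ends s t)ᶜ ∩ clusterEvent ends w A := by
      ext ω
      simp only [Set.mem_inter_iff, mem_clusterEvent, mem_clusterInEvent]
      exact ⟨fun h => h.1, fun h => ⟨h, by rw [h.2]; exact hA⟩⟩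
    have h2 : (connEvent ends s t)ᶜ ∩ clusterInEvent ends w 𝓤 ∩ Y ∩ clusterEvent ends w A =
        (connEvent ends s t)ᶜ ∩ clusterEvent ends w A ∩ Y := by
      ext ω
      simp only [Set.mem_inter_iff, mem_clusterEvent, mem_clusterInEvent]
      exact ⟨fun h => ⟨⟨h.1.1.1, h.2⟩, h.1.2⟩,
        fun h => ⟨⟨⟨h.1.1, by rw [h.1.2]; exact hA⟩, h.2⟩, h.1.2⟩⟩
    rw [h1, h2]
    by_cases h0 : prob p ((connEvent ends s t)ᶜ ∩ clusterEvent ends w A) = 0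
    · have hY0 : prob p ((connEvent ends s t)ᶜ ∩ clusterEvent ends w A ∩ Y) = 0 :=
        le_antisymm (h0 ▸ prob_mono hp Set.inter_subset_left) (prob_nonneg hp _)
      rw [h0, hY0]
      simp
    · exact mul_div_cancel_left₀ _ h0
  · have h1 : (connEvent ends s t)ᶜ ∩ clusterEvent ends w A ∩ clusterInEvent ends w 𝓤 = ∅ := by
      ext ω
      simp only [Set.mem_inter_iff, mem_clusterEvent, mem_clusterInEvent,
        Set.mem_empty_iff_false, iff_false]
      exact fun h => hA (h.1.2 ▸ h.2)
    have h2 : (connEvent ends s t)ᶜ ∩ clusterInEvent ends w 𝓤 ∩ Y ∩ clusterEvent ends w A = ∅ := by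
      ext ω
      simp only [Set.mem_inter_iff, mem_clusterEvent, mem_clusterInEvent,
        Set.mem_empty_iff_false, iff_false]
      exact fun h => hA (h.2 ▸ h.1.1.2)
    rw [h1, h2, prob_empty]
    simp

/-- BHK06 Thm 1.4 in the cleared form of (RB-cross):
`P(Q ∩ bL ∩ oH) ≤ P(Q ∩ bL) · P(Q ∩ oH) / P(Q)`. -/
theorem cross_collapsed (hp : IsProbVec p) (o b s t : V) :
    prob p ((connEvent ends s t)ᶜ ∩ connEvent ends b s ∩ connEvent ends o t) ≤
      prob p ((connEvent ends s t)ᶜ ∩ connEvent ends b s) *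
        prob p ((connEvent ends s t)ᶜ ∩ connEvent ends o t) / prob p (connEvent ends s t)ᶜ := by
  have key := bhk_cross_cluster p hp ends s t (isUpperSet_mem b) (isUpperSet_mem o)
  rw [← connEvent_eq_clusterInEvent_right ends b s, ← connEvent_eq_clusterInEvent_right ends o t,
    Set.inter_comm _ (connEvent ends s t)ᶜ, Set.inter_comm _ (connEvent ends s t)ᶜ,
    Set.inter_comm _ (connEvent ends s t)ᶜ, ← Set.inter_assoc] at key
  rcases eq_or_lt_of_le (prob_nonneg hp (connEvent ends s t)ᶜ) with h0 | h0
  · rw [← h0, div_zero]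
    exact le_antisymm (h0 ▸ prob_mono hp (Set.inter_subset_left.trans Set.inter_subset_left))
      (prob_nonneg hp _) |>.le
  · rw [le_div_iff₀ h0]
    exact key

/-- BHK06 Thm 1.3 in the cleared form of (RB-same):
`P(Q ∩ bL) · P(Q ∩ oL) / P(Q) ≤ P(Q ∩ bL ∩ oL)`. -/
theorem same_collapsed (hp : IsProbVec p) (o b s t : V) :
    prob p ((connEvent ends s t)ᶜ ∩ connEvent ends b s) *
        prob p ((connEvent ends s t)ᶜ ∩ connEvent ends o s) / prob p (connEvent ends s t)ᶜ ≤
      prob p ((connEvent ends s t)ᶜ ∩ connEvent ends b s ∩ connEvent ends o s) := by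
  have key := bhk_same_cluster_events p hp ends s t (isUpperSet_mem b) (isUpperSet_mem o)
  rw [← connEvent_eq_clusterInEvent_right ends b s, ← connEvent_eq_clusterInEvent_right ends o s,
    Set.inter_comm _ (connEvent ends s t)ᶜ, Set.inter_comm _ (connEvent ends s t)ᶜ,
    Set.inter_comm _ (connEvent ends s t)ᶜ, ← Set.inter_assoc] at key
  rcases eq_or_lt_of_le (prob_nonneg hp (connEvent ends s t)ᶜ) with h0 | h0
  · rw [← h0, div_zero]
    exact prob_nonneg hp _
  · rw [div_le_iff₀ h0]
    exact key

/-- **(RB-cross) at `w = s`** (`bL` is determined by `C(s)`): it is BHK 1.4. -/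
theorem cross_at_s (hp : IsProbVec p) (o b s t : V) :
    rbSum p ends s t s (connEvent ends b s) (connEvent ends o t) ≤
      prob p ((connEvent ends s t)ᶜ ∩ connEvent ends b s) *
        prob p ((connEvent ends s t)ᶜ ∩ connEvent ends o t) / prob p (connEvent ends s t)ᶜ := by
  rw [connEvent_eq_clusterInEvent_right ends b s, rbSum_of_clusterInEvent ends hp,
    ← connEvent_eq_clusterInEvent_right ends b s]
  exact cross_collapsed ends hp o b s t

/-- **(RB-cross) at `w = t`** (`oH` is determined by `C(t)`): it is BHK 1.4. -/
theorem cross_at_t (hp : IsProbVec p) (o b s t : V) :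
    rbSum p ends s t t (connEvent ends b s) (connEvent ends o t) ≤
      prob p ((connEvent ends s t)ᶜ ∩ connEvent ends b s) *
        prob p ((connEvent ends s t)ᶜ ∩ connEvent ends o t) / prob p (connEvent ends s t)ᶜ := by
  rw [rbSum_comm, connEvent_eq_clusterInEvent_right ends o t, rbSum_of_clusterInEvent ends hp,
    ← connEvent_eq_clusterInEvent_right ends o t, inter_inter_comm]
  exact cross_collapsed ends hp o b s t

/-- **(RB-cross) at `w = b`** (`bL = {s ∈ C(b)}` is determined by `C(b)`): it is BHK 1.4. -/
theorem cross_at_b (hp : IsProbVec p) (o b s t : V) :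
    rbSum p ends s t b (connEvent ends b s) (connEvent ends o t) ≤
      prob p ((connEvent ends s t)ᶜ ∩ connEvent ends b s) *
        prob p ((connEvent ends s t)ᶜ ∩ connEvent ends o t) / prob p (connEvent ends s t)ᶜ := by
  rw [connEvent_eq_clusterInEvent_left ends b s, rbSum_of_clusterInEvent ends hp,
    ← connEvent_eq_clusterInEvent_left ends b s]
  exact cross_collapsed ends hp o b s t

/-- **(RB-cross) at `w = o`** (`oH = {t ∈ C(o)}` is determined by `C(o)`): it is BHK 1.4. -/
theorem cross_at_o (hp : IsProbVec p) (o b s t : V) :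
    rbSum p ends s t o (connEvent ends b s) (connEvent ends o t) ≤
      prob p ((connEvent ends s t)ᶜ ∩ connEvent ends b s) *
        prob p ((connEvent ends s t)ᶜ ∩ connEvent ends o t) / prob p (connEvent ends s t)ᶜ := by
  rw [rbSum_comm, connEvent_eq_clusterInEvent_left ends o t, rbSum_of_clusterInEvent ends hp,
    ← connEvent_eq_clusterInEvent_left ends o t, inter_inter_comm]
  exact cross_collapsed ends hp o b s t

/-- **(RB-same) at `w = s`** (both events are determined by `C(s)`): it is BHK 1.3. -/
theorem same_at_s (hp : IsProbVec p) (o b s t : V) :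
    prob p ((connEvent ends s t)ᶜ ∩ connEvent ends b s) *
        prob p ((connEvent ends s t)ᶜ ∩ connEvent ends o s) / prob p (connEvent ends s t)ᶜ ≤
      rbSum p ends s t s (connEvent ends b s) (connEvent ends o s) := by
  rw [connEvent_eq_clusterInEvent_right ends b s, rbSum_of_clusterInEvent ends hp,
    ← connEvent_eq_clusterInEvent_right ends b s]
  exact same_collapsed ends hp o b s t

/-- **(RB-same) at `w = b`** (`bL = {s ∈ C(b)}` is determined by `C(b)`): it is BHK 1.3. -/
theorem same_at_b (hp : IsProbVec p) (o b s t : V) :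
    prob p ((connEvent ends s t)ᶜ ∩ connEvent ends b s) *
        prob p ((connEvent ends s t)ᶜ ∩ connEvent ends o s) / prob p (connEvent ends s t)ᶜ ≤
      rbSum p ends s t b (connEvent ends b s) (connEvent ends o s) := by
  rw [connEvent_eq_clusterInEvent_left ends b s, rbSum_of_clusterInEvent ends hp,
    ← connEvent_eq_clusterInEvent_left ends b s]
  exact same_collapsed ends hp o b s t

/-- **(RB-same) at `w = o`** (`oL = {s ∈ C(o)}` is determined by `C(o)`): it is BHK 1.3. -/
theorem same_at_o (hp : IsProbVec p) (o b s t : V) :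
    prob p ((connEvent ends s t)ᶜ ∩ connEvent ends b s) *
        prob p ((connEvent ends s t)ᶜ ∩ connEvent ends o s) / prob p (connEvent ends s t)ᶜ ≤
      rbSum p ends s t o (connEvent ends b s) (connEvent ends o s) := by
  rw [rbSum_comm, connEvent_eq_clusterInEvent_left ends o s, rbSum_of_clusterInEvent ends hp,
    ← connEvent_eq_clusterInEvent_left ends o s, inter_inter_comm]
  exact same_collapsed ends hp o b s t

omit [IsStrictOrderedRing R] in
/-- The Rao–Blackwell sum at `w = t` is `Σ_A P(Q ∩ {C(t) = A}) · f_b(A) · f_o(A)`. -/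
lemma rbSum_at_t (o b s t : V) :
    rbSum p ends s t t (connEvent ends b s) (connEvent ends o s) =
      ∑ A : Set V, prob p ((connEvent ends s t)ᶜ ∩ clusterEvent ends t A) *
        (delClusterProb p ends s {W | b ∈ W} A * delClusterProb p ends s {W | o ∈ W} A) := by
  unfold rbSum
  refine Finset.sum_congr rfl fun A _ => ?_
  rw [prob_atom_inter_conn p ends s t b A, prob_atom_inter_conn p ends s t o A]
  by_cases h0 : prob p ((connEvent ends s t)ᶜ ∩ clusterEvent ends t A) = 0
  · rw [h0]
    simp
  · field_simp

/-- **(RB-same) at `w = t`** — the B-frame same-type atom `Cov_{C_t}(f_b, f_o) ≥ 0`: BHK 1.3 for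
the antitone residual functionals `f_b(A) = P_{G ∖ A}(s ↔ b)`, `f_o` of the cluster of `t`. -/
theorem same_at_t (hp : IsProbVec p) (o b s t : V) :
    prob p ((connEvent ends s t)ᶜ ∩ connEvent ends b s) *
        prob p ((connEvent ends s t)ᶜ ∩ connEvent ends o s) / prob p (connEvent ends s t)ᶜ ≤
      rbSum p ends s t t (connEvent ends b s) (connEvent ends o s) := by
  set fb : Set V → R := delClusterProb p ends s {W | b ∈ W} with hfb
  set fo : Set V → R := delClusterProb p ends s {W | o ∈ W} with hfo
  have hb_anti : Antitone fb := delClusterProb_anti p hp ends s (isUpperSet_mem b)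
  have ho_anti : Antitone fo := delClusterProb_anti p hp ends s (isUpperSet_mem o)
  have hb1 : ∀ A, fb A ≤ 1 := delClusterProb_le_one p hp ends s _
  have ho1 : ∀ A, fo A ≤ 1 := delClusterProb_le_one p hp ends s _
  have key := bhk_same_cluster p hp ends t s (F₁ := fun A => 1 - fb A) (F₂ := fun A => 1 - fo A)
    (fun A B h => sub_le_sub_left (hb_anti h) 1) (fun A B h => sub_le_sub_left (ho_anti h) 1)
    (fun A => sub_nonneg.2 (hb1 A)) (fun A => sub_nonneg.2 (ho1 A))
  rw [← compl_connEvent_comm ends s t] at key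
  have e3 : (fun ω => (1 - fb (cluster ends ω t)) * (1 - fo (cluster ends ω t)) *
      ((connEvent ends s t)ᶜ).indicator 1 ω) =
      fun ω => (fun A => (1 - fb A) * (1 - fo A)) (cluster ends ω t) *
        ((connEvent ends s t)ᶜ).indicator 1 ω := rfl
  rw [expect_cluster_mul_indicator p ends t (fun A => 1 - fb A),
    expect_cluster_mul_indicator p ends t (fun A => 1 - fo A), e3,
    expect_cluster_mul_indicator p ends t (fun A => (1 - fb A) * (1 - fo A))] at key
  simp only [sub_mul, one_mul, mul_sub, mul_one, Finset.sum_sub_distrib] at key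
  have hQ : ∑ A : Set V, prob p ((connEvent ends s t)ᶜ ∩ clusterEvent ends t A) =
      prob p (connEvent ends s t)ᶜ := sum_prob_inter_clusterEvent p ends t _
  have hB : ∑ A : Set V, fb A * prob p ((connEvent ends s t)ᶜ ∩ clusterEvent ends t A) =
      prob p ((connEvent ends s t)ᶜ ∩ connEvent ends b s) := by
    rw [← sum_atom_mul_delClusterProb p ends s t b]
    exact Finset.sum_congr rfl fun A _ => mul_comm _ _
  have hO : ∑ A : Set V, fo A * prob p ((connEvent ends s t)ᶜ ∩ clusterEvent ends t A) =
      prob p ((connEvent ends s t)ᶜ ∩ connEvent ends o s) := by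
    rw [← sum_atom_mul_delClusterProb p ends s t o]
    exact Finset.sum_congr rfl fun A _ => mul_comm _ _
  have hS : ∑ A : Set V, fb A * fo A * prob p ((connEvent ends s t)ᶜ ∩ clusterEvent ends t A) =
      rbSum p ends s t t (connEvent ends b s) (connEvent ends o s) := by
    rw [rbSum_at_t ends o b s t]
    exact Finset.sum_congr rfl fun A _ => by ring
  rw [hQ, hB, hO, hS] at key
  rcases eq_or_lt_of_le (prob_nonneg hp (connEvent ends s t)ᶜ) with h0 | h0
  · rw [← h0, div_zero]
    exact rbSum_nonneg ends hp s t t _ _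
  · rw [div_le_iff₀ h0]
    nlinarith [key]

/-- **Row 2′RB at every root and marker**: for `w ∈ {s, t, b, o}` both (RB-cross) and (RB-same)
hold in the row's cleared form — BHK 1.4 / 1.3 through the collapse, and the B-frame atom at
`w = t` (the mirrors with `s ↔ t` swapped are the same statement with the roots renamed). -/
theorem rb_of_mem (hp : IsProbVec p) (o b s t w : V) (hw : w = s ∨ w = t ∨ w = b ∨ w = o) :
    rbSum p ends s t w (connEvent ends b s) (connEvent ends o t) ≤
        prob p ((connEvent ends s t)ᶜ ∩ connEvent ends b s) *
          prob p ((connEvent ends s t)ᶜ ∩ connEvent ends o t) / prob p (connEvent ends s t)ᶜ ∧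
      prob p ((connEvent ends s t)ᶜ ∩ connEvent ends b s) *
          prob p ((connEvent ends s t)ᶜ ∩ connEvent ends o s) / prob p (connEvent ends s t)ᶜ ≤
        rbSum p ends s t w (connEvent ends b s) (connEvent ends o s) := by
  rcases hw with rfl | rfl | rfl | rfl
  · exact ⟨cross_at_s ends hp o b w t, same_at_s ends hp o b w t⟩
  · exact ⟨cross_at_t ends hp o b s w, same_at_t ends hp o b s w⟩
  · exact ⟨cross_at_b ends hp o w s t, same_at_b ends hp o w s t⟩
  · exact ⟨cross_at_o ends hp w b s t, same_at_o ends hp w b s t⟩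

end Ordered

end RBRoot

end Summit.Ventures.PercRepro2
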